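import Summits.QuantumFields.GaugeBoot.ClassB
import Literature.MathematicalPhysics.QuantumLattice.LatticeGaugeDLRSymmetry
import HarnessLib

/-!
# The axis reflections of `ℤ^d` on links and plaquettes; the Wilson boundary actions are reflection invariant (gauge-boot, L1/L4 supplement)

HONEST FRAMING (cell `pub-gaugeboot`, page 1 of every file): the venture produces certified bounds
on lattice expectations at stated coupling, gauge group, dimension and torus size; NOT a mass gap,
NOT a continuum limit, NOT a string tension; NOT Yang–Mills-summit-bearing (barriers
`FixedCouplingUltralocality`, `PerturbativeInvisibility`). Structural; it certifies no number.

## Content (the geometry behind `BootstrapReflectionsZd`)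

The site reflection `θ_i : x_i ↦ -x_i` of `ℤ^d` acts on configurations by `configSiteReflect i`
(`ClassB`): links across the axis `i` are carried, links ALONG the axis `i` are mapped onto reversed
links and read through the inverse. The geometry (sequel `ZdReflectionRelabelling` connects it to
`BootstrapLinkReversal`, `BootstrapReflectionsZd` to the bootstrap):

* `zdSiteReflect_apply/_add/_single_self/_single_ne/_comm/_sitePerm` — `θ_i` is additive, reverses
  `e_i`, fixes `e_k`, the `θ_i` commute, and axis permutations conjugate them;
* `zdReflEdge i` — the link read by the reflection (`(θ_i x - e_i, i)` for an `i`-link `(x, i)`,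
  `(θ_i x, k)` for a `k`-link, `k ≠ i`); an involution (`zdReflEdgeEquiv`); `zdReflEdge_edgeShift`,
  `zdReflEdge_edgePerm`, `zdReflEdge_comm` — it normalises translations, is conjugated by axis
  permutations, and the `d` of them commute;
* `zdReflPlaquette i` — the reflected plaquette (base point `θ_i x - e_i` if the plane contains the
  axis `i`, `θ_i x` otherwise; same plane); `plaquetteEdges_zdReflPlaquette`,
  `plaquettesTouching_map_zdReflEdge`; `plaquetteHolonomyZd_siteReflect_zdReflPlaquette` — the
  reflected configuration's holonomy around the reflected plaquette is the original one if the plane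
  misses the axis and a conjugate of its INVERSE otherwise; ★ `plaquetteObs_zdReflPlaquette_siteReflect`
  — so the plaquette variable `Re tr ρ` is unchanged (`Re tr ρ(g⁻¹) = Re tr ρ(g)`, compact group);
* ★★ `wilsonBoundaryAction_map_zdReflEdge_siteReflect` — `S_{θ_i Λ}(Θ_i U) = S_Λ(U)`.

References: K. Osterwalder, E. Seiler, Ann. Phys. 110 (1978) 440 (the reflection of a lattice
gauge field); E. Seiler, LNP 159 (1982) Ch. 2; V. Kazakov, Z. Zheng, arXiv:2203.11360 §3.3.
Folklore.
-/

noncomputable section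

open Literature.Probability.LatticeModels (Site)
open Literature.MathematicalPhysics.QuantumLattice

namespace Summit.QuantumFields.GaugeBoot

/-! ## The site reflection on sites -/

section Sites

variable {d : ℕ} (i : Fin d)

/-- `θ_i` evaluated. -/
theorem zdSiteReflect_apply (x : Site d) (k : Fin d) :
    zdSiteReflect i x k = if k = i then -x i else x k := by
  unfold zdSiteReflect
  by_cases hk : k = i
  · subst hk; rw [Function.update_self, if_pos rfl]
  · rw [Function.update_of_ne hk, if_neg hk]

/-- `θ_i` is additive. -/
theorem zdSiteReflect_add (x y : Site d) : zdSiteReflect i (x + y) = zdSiteReflect i x + zdSiteReflect i y := by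
  ext k
  simp only [zdSiteReflect_apply, Pi.add_apply]
  split_ifs with hk
  · subst hk; ring
  · rfl

/-- `θ_i` reverses the `i`-th unit vector. -/
theorem zdSiteReflect_single_self (c : ℤ) : zdSiteReflect i (Pi.single i c : Site d) = -Pi.single i c := by
  ext k
  simp only [zdSiteReflect_apply, Pi.neg_apply]
  split_ifs with hk
  · subst hk; rfl
  · rw [Pi.single_eq_of_ne hk, neg_zero]

/-- `θ_i` fixes the other unit vectors. -/
theorem zdSiteReflect_single_ne {k : Fin d} (hk : k ≠ i) (c : ℤ) :
    zdSiteReflect i (Pi.single k c : Site d) = Pi.single k c := by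
  ext m
  simp only [zdSiteReflect_apply]
  split_ifs with hm
  · subst hm; rw [Pi.single_eq_of_ne (Ne.symm hk), neg_zero]
  · rfl

/-- `θ_i (x + e_i) = θ_i x - e_i`. -/
theorem zdSiteReflect_add_single_self (x : Site d) :
    zdSiteReflect i (x + Pi.single i 1) = zdSiteReflect i x - Pi.single i 1 := by
  rw [zdSiteReflect_add, zdSiteReflect_single_self, ← sub_eq_add_neg]

/-- `θ_i (x + e_k) = θ_i x + e_k` for `k ≠ i`. -/
theorem zdSiteReflect_add_single_ne (x : Site d) {k : Fin d} (hk : k ≠ i) :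
    zdSiteReflect i (x + Pi.single k 1) = zdSiteReflect i x + Pi.single k 1 := by
  rw [zdSiteReflect_add, zdSiteReflect_single_ne i hk]

/-- `θ_i (θ_i x - e_i) = x + e_i`. -/
theorem zdSiteReflect_zdSiteReflect_sub_single (x : Site d) :
    zdSiteReflect i (zdSiteReflect i x - Pi.single i 1) = x + Pi.single i 1 := by
  rw [zdSiteReflect_sub_single, zdSiteReflect_zdSiteReflect]

/-- Two site reflections commute. -/
theorem zdSiteReflect_comm (j : Fin d) (x : Site d) :
    zdSiteReflect i (zdSiteReflect j x) = zdSiteReflect j (zdSiteReflect i x) := by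
  ext k
  simp only [zdSiteReflect_apply]
  split_ifs with h1 h2 <;> subst_vars <;> simp_all

/-- `θ_i (x ∘ σ⁻¹) = (θ_{σ⁻¹ i} x) ∘ σ⁻¹`: axis permutations conjugate the reflections. -/
theorem zdSiteReflect_sitePerm (σ : Equiv.Perm (Fin d)) (x : Site d) :
    zdSiteReflect i (sitePerm σ x) = sitePerm σ (zdSiteReflect (σ.symm i) x) := by
  ext k
  simp only [zdSiteReflect_apply, sitePerm_apply, Equiv.apply_eq_iff_eq]

/-- `sitePerm σ` commutes with subtraction. -/
theorem sitePerm_sub (σ : Equiv.Perm (Fin d)) (x y : Site d) :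
    sitePerm σ (x - y) = sitePerm σ x - sitePerm σ y := rfl

end Sites

/-! ## The link read by the reflection -/

section Edges

variable {d : ℕ} (i : Fin d)

/-- **The link read by the reflection `θ_i`**: an `i`-link `(x, i)` is mapped onto the REVERSED
link ending at `θ_i x`, i.e. the positively oriented link `(θ_i x - e_i, i)`; a `k`-link (`k ≠ i`)
onto `(θ_i x, k)`. [folklore] -/
def zdReflEdge (e : ZdEdge d) : ZdEdge d :=
  if e.2 = i then (zdSiteReflect i e.1 - Pi.single i 1, i) else (zdSiteReflect i e.1, e.2)

/-- `zdReflEdge` on an `i`-link. -/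
theorem zdReflEdge_of_eq {e : ZdEdge d} (he : e.2 = i) :
    zdReflEdge i e = (zdSiteReflect i e.1 - Pi.single i 1, i) := if_pos he

/-- `zdReflEdge` on a `k`-link, `k ≠ i`. -/
theorem zdReflEdge_of_ne {e : ZdEdge d} (he : e.2 ≠ i) :
    zdReflEdge i e = (zdSiteReflect i e.1, e.2) := if_neg he

/-- `zdReflEdge` preserves the axis. -/
@[simp] theorem zdReflEdge_snd (e : ZdEdge d) : (zdReflEdge i e).2 = e.2 := by
  by_cases he : e.2 = i
  · rw [zdReflEdge_of_eq i he, he]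
  · rw [zdReflEdge_of_ne i he]

/-- `zdReflEdge` is an involution. -/
@[simp] theorem zdReflEdge_zdReflEdge (e : ZdEdge d) : zdReflEdge i (zdReflEdge i e) = e := by
  by_cases he : e.2 = i
  · rw [zdReflEdge_of_eq i (e := zdReflEdge i e) (by rw [zdReflEdge_snd, he]), zdReflEdge_of_eq i he,
      zdSiteReflect_zdSiteReflect_sub_single, add_sub_cancel_right]
    exact Prod.ext rfl he.symm
  · rw [zdReflEdge_of_ne i (e := zdReflEdge i e) (by rw [zdReflEdge_snd]; exact he), zdReflEdge_of_ne i he,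
      zdSiteReflect_zdSiteReflect]

/-- `zdReflEdge` is injective. -/
theorem zdReflEdge_injective : Function.Injective (zdReflEdge (d := d) i) := fun e e' h => by
  rw [← zdReflEdge_zdReflEdge i e, h, zdReflEdge_zdReflEdge]

/-- `zdReflEdge` as a bijection of the links. -/
def zdReflEdgeEquiv : ZdEdge d ≃ ZdEdge d where
  toFun := zdReflEdge i
  invFun := zdReflEdge i
  left_inv := zdReflEdge_zdReflEdge i
  right_inv := zdReflEdge_zdReflEdge i

/-- `zdReflEdgeEquiv` evaluated. -/
@[simp] theorem zdReflEdgeEquiv_apply (e : ZdEdge d) : zdReflEdgeEquiv i e = zdReflEdge i e := rfl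

/-- **The reflection normalises the translations**: `θ_i (e + v) = θ_i e + θ_i v`. -/
theorem zdReflEdge_edgeShift (v : Site d) (e : ZdEdge d) :
    zdReflEdge i (edgeShift v e) = edgeShift (zdSiteReflect i v) (zdReflEdge i e) := by
  by_cases he : e.2 = i
  · rw [zdReflEdge_of_eq i (show (edgeShift v e).2 = i from he), zdReflEdge_of_eq i he]
    simp only [edgeShift_apply, zdSiteReflect_add, Prod.mk.injEq, and_true]
    abel
  · rw [zdReflEdge_of_ne i (show (edgeShift v e).2 ≠ i from he), zdReflEdge_of_ne i he]
    simp only [edgeShift_apply, zdSiteReflect_add]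

/-- **Axis permutations conjugate the reflections**: `θ_i (π_σ e) = π_σ (θ_{σ⁻¹ i} e)`. -/
theorem zdReflEdge_edgePerm (σ : Equiv.Perm (Fin d)) (e : ZdEdge d) :
    zdReflEdge i (edgePerm σ e) = edgePerm σ (zdReflEdge (σ.symm i) e) := by
  have hσ : σ (σ.symm i) = i := σ.apply_symm_apply i
  by_cases he : e.2 = σ.symm i
  · have he' : (edgePerm σ e).2 = i := by
      rw [Literature.MathematicalPhysics.QuantumLattice.edgePerm_apply, he, hσ]
    rw [zdReflEdge_of_eq i he', zdReflEdge_of_eq _ he]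
    refine Prod.ext ?_ ?_
    · simp only [Literature.MathematicalPhysics.QuantumLattice.edgePerm_apply]
      rw [zdSiteReflect_sitePerm, sitePerm_sub, sitePerm_single, hσ]
    · simp only [Literature.MathematicalPhysics.QuantumLattice.edgePerm_apply, hσ]
  · have he' : (edgePerm σ e).2 ≠ i := by
      rw [Literature.MathematicalPhysics.QuantumLattice.edgePerm_apply]
      intro h
      exact he (by rw [← h, Equiv.symm_apply_apply])
    rw [zdReflEdge_of_ne i he', zdReflEdge_of_ne _ he]
    simp only [Literature.MathematicalPhysics.QuantumLattice.edgePerm_apply, zdSiteReflect_sitePerm]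

/-- **The reflections commute** on links. -/
theorem zdReflEdge_comm (j : Fin d) (e : ZdEdge d) :
    zdReflEdge i (zdReflEdge j e) = zdReflEdge j (zdReflEdge i e) := by
  by_cases hij : i = j
  · rw [hij]
  obtain ⟨x, k⟩ := e
  by_cases hki : k = i
  · subst hki
    rw [zdReflEdge_of_ne j (e := (x, k)) hij, zdReflEdge_of_eq k (e := (x, k)) rfl,
      zdReflEdge_of_eq k (e := (zdSiteReflect j x, k)) rfl,
      zdReflEdge_of_ne j (e := (zdSiteReflect k x - Pi.single k 1, k)) hij]
    refine Prod.ext ?_ rfl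
    change zdSiteReflect k (zdSiteReflect j x) - Pi.single k 1 =
      zdSiteReflect j (zdSiteReflect k x - Pi.single k 1)
    rw [sub_eq_add_neg, sub_eq_add_neg, zdSiteReflect_add, zdSiteReflect_comm k j x, ← Pi.single_neg,
      zdSiteReflect_single_ne j hij]
  · by_cases hkj : k = j
    · subst hkj
      rw [zdReflEdge_of_eq k (e := (x, k)) rfl, zdReflEdge_of_ne i (e := (x, k)) hki,
        zdReflEdge_of_ne i (e := (zdSiteReflect k x - Pi.single k 1, k)) hki,
        zdReflEdge_of_eq k (e := (zdSiteReflect i x, k)) rfl]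
      refine Prod.ext ?_ rfl
      change zdSiteReflect i (zdSiteReflect k x - Pi.single k 1) =
        zdSiteReflect k (zdSiteReflect i x) - Pi.single k 1
      rw [sub_eq_add_neg, sub_eq_add_neg, zdSiteReflect_add, zdSiteReflect_comm i k x, ← Pi.single_neg,
        zdSiteReflect_single_ne i hki]
    · rw [zdReflEdge_of_ne j (e := (x, k)) hkj, zdReflEdge_of_ne i (e := (x, k)) hki,
        zdReflEdge_of_ne i (e := (zdSiteReflect j x, k)) hki, zdReflEdge_of_ne j (e := (zdSiteReflect i x, k)) hkj]
      exact Prod.ext (zdSiteReflect_comm i j x) rfl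

end Edges

/-! ## Plaquettes under the reflection; covariance of the Wilson boundary actions -/

section Plaquettes

variable {d : ℕ} (i : Fin d)

/-- **The reflected plaquette**: base point `θ_i x - e_i` if the plane contains the axis `i`,
`θ_i x` otherwise; the plane is kept. [folklore] -/
def zdReflPlaquette (p : ZdPlaquette d) : ZdPlaquette d :=
  (if p.2.1.1 = i ∨ p.2.1.2 = i then zdSiteReflect i p.1 - Pi.single i 1 else zdSiteReflect i p.1, p.2)

/-- `zdReflPlaquette` is an involution. -/
@[simp] theorem zdReflPlaquette_zdReflPlaquette (p : ZdPlaquette d) :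
    zdReflPlaquette i (zdReflPlaquette i p) = p := by
  obtain ⟨x, q⟩ := p
  unfold zdReflPlaquette
  by_cases h : q.1.1 = i ∨ q.1.2 = i
  · simp only [h, ↓reduceIte, zdSiteReflect_zdSiteReflect_sub_single, add_sub_cancel_right]
  · simp only [h, ↓reduceIte, zdSiteReflect_zdSiteReflect]

/-- `zdReflPlaquette` as a bijection. -/
def zdReflPlaquetteEquiv : ZdPlaquette d ≃ ZdPlaquette d where
  toFun := zdReflPlaquette i
  invFun := zdReflPlaquette i
  left_inv := zdReflPlaquette_zdReflPlaquette i
  right_inv := zdReflPlaquette_zdReflPlaquette i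

/-- `zdReflPlaquetteEquiv` evaluated. -/
@[simp] theorem zdReflPlaquetteEquiv_apply (p : ZdPlaquette d) :
    zdReflPlaquetteEquiv i p = zdReflPlaquette i p := rfl

/-- **The edges of the reflected plaquette are the reflected edges.** -/
theorem plaquetteEdges_zdReflPlaquette (p : ZdPlaquette d) :
    plaquetteEdges (zdReflPlaquette i p) = (plaquetteEdges p).map (zdReflEdgeEquiv i).toEmbedding := by
  obtain ⟨x, ⟨⟨a, b⟩, hab⟩⟩ := p
  have hne : a ≠ b := ne_of_lt hab
  simp only [plaquetteEdges, Finset.map_insert, Finset.map_singleton, Equiv.toEmbedding_apply,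
    zdReflEdgeEquiv_apply, zdReflPlaquette]
  by_cases ha : a = i
  · subst ha
    have hb : b ≠ a := Ne.symm hne
    rw [if_pos (Or.inl rfl), zdReflEdge_of_eq a (e := (x, a)) rfl,
      zdReflEdge_of_ne a (e := (x + Pi.single a 1, b)) hb,
      zdReflEdge_of_eq a (e := (x + Pi.single b 1, a)) rfl, zdReflEdge_of_ne a (e := (x, b)) hb]
    simp only [zdSiteReflect_add_single_self, zdSiteReflect_add_single_ne a _ hb, sub_add_cancel,
      sub_add_eq_add_sub]
    ext e
    simp only [Finset.mem_insert, Finset.mem_singleton]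
    tauto
  · by_cases hb : b = i
    · subst hb
      rw [if_pos (Or.inr rfl), zdReflEdge_of_ne b (e := (x, a)) ha,
        zdReflEdge_of_eq b (e := (x + Pi.single a 1, b)) rfl,
        zdReflEdge_of_ne b (e := (x + Pi.single b 1, a)) ha, zdReflEdge_of_eq b (e := (x, b)) rfl]
      simp only [zdSiteReflect_add_single_self, zdSiteReflect_add_single_ne b _ hne, sub_add_cancel,
        sub_add_eq_add_sub]
      ext e
      simp only [Finset.mem_insert, Finset.mem_singleton]
      tauto
    · have h : ¬ (a = i ∨ b = i) := not_or.2 ⟨ha, hb⟩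
      rw [if_neg h, zdReflEdge_of_ne i (e := (x, a)) ha, zdReflEdge_of_ne i (e := (x + Pi.single a 1, b)) hb,
        zdReflEdge_of_ne i (e := (x + Pi.single b 1, a)) ha, zdReflEdge_of_ne i (e := (x, b)) hb]
      simp only [zdSiteReflect_add_single_ne i _ ha, zdSiteReflect_add_single_ne i _ hb]

/-- **The plaquettes touching a reflected edge set are the reflected plaquettes.** -/
theorem plaquettesTouching_map_zdReflEdge (Λ : Finset (ZdEdge d)) :
    plaquettesTouching (Λ.map (zdReflEdgeEquiv i).toEmbedding) =
      (plaquettesTouching Λ).map (zdReflPlaquetteEquiv i).toEmbedding := by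
  ext p
  rw [Finset.mem_map_equiv, mem_plaquettesTouching_iff, mem_plaquettesTouching_iff]
  have hp : p = zdReflPlaquette i ((zdReflPlaquetteEquiv i).symm p) :=
    (zdReflPlaquette_zdReflPlaquette i p).symm
  conv_lhs => rw [hp, plaquetteEdges_zdReflPlaquette, ← Finset.map_inter, Finset.map_nonempty]

variable {G : Type*} [Group G]

/-- **The holonomy of the reflected configuration around the reflected plaquette**: the original
holonomy if the plane misses the axis; otherwise a conjugate of the INVERSE holonomy (the reflection
reverses the orientation of the plane). -/
theorem plaquetteHolonomyZd_siteReflect_zdReflPlaquette (U : LGConfig d G) (x : Site d) {a b : Fin d}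
    (hab : a < b) :
    plaquetteHolonomyZd (configSiteReflect i U) (zdReflPlaquette i (x, ⟨(a, b), hab⟩)).1 a b =
      if a = i then (U (x, a))⁻¹ * (plaquetteHolonomyZd U x a b)⁻¹ * ((U (x, a))⁻¹)⁻¹
      else if b = i then (U (x, b))⁻¹ * (plaquetteHolonomyZd U x a b)⁻¹ * ((U (x, b))⁻¹)⁻¹
      else plaquetteHolonomyZd U x a b := by
  have hne : a ≠ b := ne_of_lt hab
  by_cases ha : a = i
  · subst ha
    have hb : b ≠ a := Ne.symm hne
    rw [if_pos rfl]
    simp only [zdReflPlaquette, true_or, ↓reduceIte, plaquetteHolonomyZd, configSiteReflect, hb]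
    simp only [sub_add_cancel, zdSiteReflect_zdSiteReflect, zdSiteReflect_add_single_ne a _ hb,
      zdSiteReflect_zdSiteReflect_sub_single, add_sub_cancel_right, add_sub_right_comm]
    group
  · by_cases hb : b = i
    · subst hb
      rw [if_neg ha, if_pos rfl]
      simp only [zdReflPlaquette, or_true, ↓reduceIte, plaquetteHolonomyZd, configSiteReflect, ha]
      simp only [sub_add_cancel, zdSiteReflect_zdSiteReflect, zdSiteReflect_add_single_ne b _ hne,
        zdSiteReflect_zdSiteReflect_sub_single, add_sub_cancel_right, add_sub_right_comm]
      group
    · rw [if_neg ha, if_neg hb]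
      simp only [zdReflPlaquette, plaquetteHolonomyZd, configSiteReflect, ha, hb, false_or, ↓reduceIte]
      simp only [zdSiteReflect_add_single_ne i _ ha, zdSiteReflect_add_single_ne i _ hb,
        zdSiteReflect_zdSiteReflect]

variable {N : ℕ} (ρ : G →* Matrix (Fin N) (Fin N) ℂ) [TopologicalSpace G] [IsTopologicalGroup G]
  [CompactSpace G]

/-- ★ **The plaquette variable of the reflected configuration at the reflected plaquette is the
original one** (`Re tr ρ(h g⁻¹ h⁻¹) = Re tr ρ(g)` for a continuous representation of a compact
group). -/
theorem plaquetteObs_zdReflPlaquette_siteReflect (hρ : Continuous ρ) (U : LGConfig d G) (p : ZdPlaquette d) :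
    plaquetteObs ρ (zdReflPlaquette i p).1 p.2.1.1 p.2.1.2 (configSiteReflect i U) =
      plaquetteObs ρ p.1 p.2.1.1 p.2.1.2 U := by
  obtain ⟨x, ⟨⟨a, b⟩, hab⟩⟩ := p
  simp only [plaquetteObs]
  rw [plaquetteHolonomyZd_siteReflect_zdReflPlaquette i U x hab]
  split_ifs
  · rw [Literature.RepresentationTheory.CompactGroups.CompactGroup.trace_conj_eq,
      Literature.RepresentationTheory.CompactGroups.CompactGroup.re_trace_map_inv ρ hρ]
  · rw [Literature.RepresentationTheory.CompactGroups.CompactGroup.trace_conj_eq,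
      Literature.RepresentationTheory.CompactGroups.CompactGroup.re_trace_map_inv ρ hρ]
  · rfl

/-- ★★ **The boundary Wilson action is reflection invariant**: `S_{θ_i Λ}(Θ_i U) = S_Λ(U)`.
[cite: OsterwalderSeiler1978, §2 (invariance of the Wilson action under lattice reflections)] -/
theorem wilsonBoundaryAction_map_zdReflEdge_siteReflect (hρ : Continuous ρ) (Λ : Finset (ZdEdge d))
    (U : LGConfig d G) :
    wilsonBoundaryAction ρ (Λ.map (zdReflEdgeEquiv i).toEmbedding) (configSiteReflect i U) =
      wilsonBoundaryAction ρ Λ U := by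
  unfold wilsonBoundaryAction
  rw [plaquettesTouching_map_zdReflEdge, Finset.sum_map]
  refine Finset.sum_congr rfl fun p _ => ?_
  rw [Equiv.toEmbedding_apply, zdReflPlaquetteEquiv_apply]
  have h2 : (zdReflPlaquette i p).2 = p.2 := rfl
  rw [h2, plaquetteObs_zdReflPlaquette_siteReflect i ρ hρ U p]

end Plaquettes

end Summit.QuantumFields.GaugeBoot

end
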